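import Summits.Ventures.HSemireg.WedgeWeilPurityCompression
import Summits.Ventures.HSemireg.WedgeWeilPuritySchurMirror

/-!
# Venture HSemireg — W-PURITY(ρ), compression (3/3): the ONE-SIDED columns (a = 0 or b = 0) in closed form, every field

HONEST FRAMING. Part of the Lean index of the computation cell `pub-hsemireg` (second enclosure wave; this file is seat p6's own
text, gen 8, in the conventions of seat p3's ENCLOSURE-PLAN-p3.md).  Finite-dimensional exterior algebra over a field ONLY:
no variety, no cohomology theory, no semiregularity map is constructed here; nothing here says that HC / HC_CM / HC_AV holds;
no Literature fact is declared or used.  The geometric DICTIONARY (why these ranks are the `HT`-side box ranks of the cell's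
STRUCTURE.md §1 / theory/FORMULA-N.md) lives in theory/FORMULA-N-th7.md PART B §A.3 / §N and is NOT asserted in Lean.

File 3 of the COMPRESSION (files 1–2: `WedgeWeilPurityBlockForms.lean`, `WedgeWeilPurityCompression.lean`).  There the two-sided
case `a ≠ 0 ≠ b` came out of an eigenvector correspondence (`u ≠ 0`).  The ONE-SIDED columns (`u = ab = 0`) need the rank of
`ψ₋ψ₊ ∣ E₊` (resp. `ψ₊ψ₋ ∣ E₋`) itself, hence that `ι±` is INJECTIVE and `Φ± ∣ E±` is ONTO.  Both hold in EVERY characteristic,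
by multiplying with a complementary block product: `op S · eps l = [|S| + l = m] · (−1)^{C(m,2)+|S|} · Π(x_c ∧ y_c)` (`op_mul_eps`),
so `op S · ι x` isolates one coordinate of `x` (`op_mul_sum_eps`) and `Φ(op S)` is a non-zero multiple of a unit vector (`PhiP_op`).
Results (Weil type `(n,n)`, `m = n ≥ 1`, every `q`, every field):
* `Mcomp_eq_HOmegaH` — `M(q) = H_n(q) Ω_n H_n(q)` EXACTLY (the signs `(−1)^{n·n}(−1)ⁿ` cancel; th-7's `Ω_n` verbatim);
* `psiP_psiM_eq` — the mirror factorisation `ψ₊ψ₋ ∣ E₋ = ι₋ ∘ M(q) ∘ Φ₋`;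
* `iotaP_injective` / `iotaM_injective`, `exists_EP_PhiP_eq` / `exists_EM_PhiM_eq`;
* `finrank_map_psiMP` / `finrank_map_psiPM` — **`rank(ψ₋ψ₊ ∣ E₊) = rank(ψ₊ψ₋ ∣ E₋) = rank(H_n(q) Ω_n H_n(q))`**;
* **`weilPurity_oneSided_b_zero`** (`a ≠ 0`, `b = 0`) and **`weilPurity_oneSided_a_zero`** (`a = 0`, `b ≠ 0`):
  `finrank range(∧v ∣ HTⁿ) + 2ρ + C(2n,n) = C(2n,n)·ρ + 2·C(2n,n) + rank(H_n(q) Ω_n H_n(q))`, i.e.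
  **rank `= C(2n,n)(1+ρ) − 2ρ + rank(H_n Ω_n H_n)`** — th-7's one-sided value `R₀` (FORMULA-N PART B §L.11, bus l.8796; formerly
  «compression DERIVED ×2 / EXACT n ≤ 7», red-7 F-95 / NOT-CITABLE (28)) as a kernel theorem, every field, every `q`.
Also recorded (not used below): `Omega'_mulVec_Omega'_mulVec` (`Ω′Ω′ = (−1)ⁿ·diag(C(n,j)²)`).
Not here: the value of `rank(H_n Ω_n H_n)` in terms of `ρ` and the parity of `n` (th-6 g8 APOLAR-GRAM-RANK, th-7 g8 APOLAR-SIGN-LAWS,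
th-6's Literature `SylvesterRuleOfSigns` — the piece after this one).
-/

open Module Set Set.powersetCard Summit.Ventures.HSemireg.Wedge.Hankel

namespace Summit.Ventures.HSemireg.Wedge.Weil

variable (K : Type*) [Field K]

section OneSided

variable {n : ℕ}

open Summit.Ventures.HSemireg.Wedge.WeilPurity (pp r r_ne_zero card_Dm_nn card_Gm_nn)

/-! ### `Ω′Ω′ = (−1)ⁿ·diag(C(n,j)²)` (record) -/

/-- `Ω′ (Ω′ x) = ((−1)ⁿ · C(n,j)² · x_j)_j`. -/
lemma Omega'_mulVec_Omega'_mulVec (x : Fin (n + 1) → K) :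
    (Omega' K n).mulVec ((Omega' K n).mulVec x) =
      fun j : Fin (n + 1) => ((-1 : K) ^ n * (n.choose (j : ℕ) : K) ^ 2) * x j := by
  ext j
  have hj : (j : ℕ) ≤ n := by omega
  set jc : Fin (n + 1) := ⟨n - (j : ℕ), by omega⟩ with hjc
  have hjcv : (jc : ℕ) = n - (j : ℕ) := rfl
  rw [mulVec_apply', Finset.sum_eq_single jc]
  · rw [mulVec_apply', Finset.sum_eq_single j]
    · rw [Omega'_apply, Omega'_apply, if_pos (by rw [hjcv]; omega), if_pos (by rw [hjcv]; omega), hjcv,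
        Nat.choose_symm hj]
      have hs : ((-1 : K) ^ (n - (j : ℕ))) * (-1) ^ (j : ℕ) = (-1) ^ n := by
        rw [← pow_add, Nat.sub_add_cancel hj]
      linear_combination ((n.choose (j : ℕ) : K) ^ 2 * x j) * hs
    · intro k _ hk
      rw [Omega'_apply, if_neg (fun h => hk (Fin.ext (by rw [hjcv] at h; omega))), zero_mul]
    · intro h; exact absurd (Finset.mem_univ _) h
  · intro j' _ hj'
    rw [Omega'_apply, if_neg (fun h => hj' (Fin.ext (by rw [hjcv]; omega))), zero_mul]
  · intro h; exact absurd (Finset.mem_univ _) h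


/-! ### Complementary block products isolate coordinates (every characteristic) -/

/-- the pair products `Π(x_c ∧ y_c)` of the lower and the upper block are non-zero. -/
lemma pp_block_ne_zero (s : ℕ) (hs : s = 0 ∨ s = n) : pp K n s n ≠ 0 := by
  rcases hs with h | h <;> rw [h]
  · rw [pp_zero_eq]; exact smul_ne_zero (r_ne_zero K) ((B K (In (n + n))).ne_zero _)
  · rw [pp_n_eq]; exact smul_ne_zero (r_ne_zero K) ((B K (In (n + n))).ne_zero _)

/-- a block product against the block forms: `op S · eps l = [|S| + l = m]·(−1)^{C(m,2)+|S|}·Π(x_c∧y_c)` for `S ⊆ [0,m)`. -/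
lemma op_mul_eps (s m l : ℕ) {S : Finset ℕ} (hS : S ⊆ Finset.range m) :
    op K n s m S * eps K n s m l =
      (if S.card + l = m then ((-1 : K) ^ (m.choose 2 + S.card)) else 0) • pp K n s m := by
  classical
  have hint : S ∩ Finset.range m = S := Finset.inter_eq_left.mpr hS
  have hSm : S.card ≤ m := by
    have := Finset.card_le_card hS
    rwa [Finset.card_range] at this
  rw [eps, Finset.mul_sum]
  by_cases hl : S.card + l = m
  · rw [if_pos hl]
    have hmem : Finset.range m \ S ∈ (Finset.range m).powersetCard l := by
      rw [Finset.mem_powersetCard]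
      refine ⟨Finset.sdiff_subset, ?_⟩
      rw [Finset.card_sdiff_of_subset hS, Finset.card_range]
      omega
    rw [Finset.sum_eq_single (Finset.range m \ S)]
    · rw [op_mul_op_compl K s _ S m (compl_cond m S), hint]
    · intro S' hS' hne
      exact op_mul_op_eq_zero K s S' S m (exists_shared (Finset.mem_powersetCard.mp hS').1 hne)
    · intro h; exact absurd hmem h
  · rw [if_neg hl, zero_smul]
    apply Finset.sum_eq_zero
    intro S' hS'
    obtain ⟨hS'sub, hS'card⟩ := Finset.mem_powersetCard.mp hS'
    apply op_mul_op_eq_zero K s S' S m (exists_shared hS'sub ?_)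
    intro heq
    apply hl
    rw [heq, Finset.card_sdiff_of_subset hS, Finset.card_range] at hS'card
    omega

/-- the standard block product with `n − l` letters `y` isolates the `l`-th coordinate of `Σ x_l' eps l'` (either block). -/
lemma op_mul_sum_eps (s : ℕ) (x : Fin (n + 1) → K) (l : Fin (n + 1)) :
    op K n s n (Finset.range (n - (l : ℕ))) * ∑ l' : Fin (n + 1), x l' • eps K n s n l' =
      (x l * (-1 : K) ^ (n.choose 2 + (n - (l : ℕ)))) • pp K n s n := by
  have hsub : Finset.range (n - (l : ℕ)) ⊆ Finset.range n := by
    intro a ha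
    rw [Finset.mem_range] at ha ⊢
    omega
  rw [Finset.mul_sum, Finset.sum_eq_single l]
  · rw [mul_smul_comm, op_mul_eps K s n _ hsub, Finset.card_range,
      if_pos (show n - (l : ℕ) + (l : ℕ) = n by omega), smul_smul]
  · intro l' _ hl'
    rw [mul_smul_comm, op_mul_eps K s n _ hsub, Finset.card_range,
      if_neg (show ¬ (n - (l : ℕ) + (l' : ℕ) = n) from fun h => hl' (Fin.ext (by omega))), zero_smul, smul_zero]
  · intro h; exact absurd (Finset.mem_univ _) h

/-- `ι₊` is injective (every field). -/
lemma iotaP_injective : Function.Injective (iotaP K n) := by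
  intro x y hxy
  funext l
  have h := congrArg (fun z => op K n n n (Finset.range (n - (l : ℕ))) * z) hxy
  simp only [iotaP_apply, op_mul_sum_eps] at h
  have hc : ((-1 : K) ^ (n.choose 2 + (n - (l : ℕ)))) ≠ 0 := pow_ne_zero _ (neg_ne_zero.mpr one_ne_zero)
  exact mul_right_cancel₀ hc (smul_left_injective K (pp_block_ne_zero K n (Or.inr rfl)) h)

/-- `ι₋` is injective (every field). -/
lemma iotaM_injective : Function.Injective (iotaM K n) := by
  intro x y hxy
  funext l
  have h := congrArg (fun z => op K n 0 n (Finset.range (n - (l : ℕ))) * z) hxy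
  simp only [iotaM_apply, op_mul_sum_eps] at h
  have hc : ((-1 : K) ^ (n.choose 2 + (n - (l : ℕ)))) ≠ 0 := pow_ne_zero _ (neg_ne_zero.mpr one_ne_zero)
  exact mul_right_cancel₀ hc (smul_left_injective K (pp_block_ne_zero K 0 (Or.inl rfl)) h)

/-- `Φ₊` of a standard upper block product is a non-zero multiple of a unit vector. -/
lemma PhiP_op (l : Fin (n + 1)) :
    PhiP K n (op K n n n (Finset.range (n - (l : ℕ)))) =
      Pi.single l (((-1 : K) ^ (n.choose 2 + (n - (l : ℕ)))) * r K n) := by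
  have hsub : Finset.range (n - (l : ℕ)) ⊆ Finset.range n := by
    intro a ha
    rw [Finset.mem_range] at ha ⊢
    omega
  funext l'
  rw [PhiP_apply, phiP_apply, op_mul_eps K n n _ hsub, Finset.card_range, pp_n_eq, smul_smul, map_smul,
    coord_B_self, smul_eq_mul, mul_one]
  by_cases h : l' = l
  · rw [h, Pi.single_eq_same, if_pos (show n - (l : ℕ) + (l : ℕ) = n by omega)]
  · rw [Pi.single_eq_of_ne h, if_neg (show ¬ (n - (l : ℕ) + (l' : ℕ) = n) from fun hh => h (Fin.ext (by omega))),
      zero_mul]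

/-- `Φ₋` of a standard lower block product is a non-zero multiple of a unit vector. -/
lemma PhiM_op (l : Fin (n + 1)) :
    PhiM K n (op K n 0 n (Finset.range (n - (l : ℕ)))) =
      Pi.single l (((-1 : K) ^ (n.choose 2 + (n - (l : ℕ)))) * r K n) := by
  have hsub : Finset.range (n - (l : ℕ)) ⊆ Finset.range n := by
    intro a ha
    rw [Finset.mem_range] at ha ⊢
    omega
  funext l'
  rw [PhiM_apply, phiM_apply, op_mul_eps K 0 n _ hsub, Finset.card_range, pp_zero_eq, smul_smul, map_smul,
    coord_B_self, smul_eq_mul, mul_one]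
  by_cases h : l' = l
  · rw [h, Pi.single_eq_same, if_pos (show n - (l : ℕ) + (l : ℕ) = n by omega)]
  · rw [Pi.single_eq_of_ne h, if_neg (show ¬ (n - (l : ℕ) + (l' : ℕ) = n) from fun hh => h (Fin.ext (by omega))),
      zero_mul]

/-- the coefficient of the unit vector in `Φ±(op …)` is non-zero. -/
lemma coeff_ne_zero (l : Fin (n + 1)) : ((-1 : K) ^ (n.choose 2 + (n - (l : ℕ)))) * r K n ≠ 0 :=
  mul_ne_zero (pow_ne_zero _ (neg_ne_zero.mpr one_ne_zero)) (r_ne_zero K)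

/-- `Φ₊` maps `E₊` ONTO the type space (every field). -/
lemma exists_EP_PhiP_eq (y : Fin (n + 1) → K) :
    ∃ θ ∈ Hom K (In (n + n)) (Gm (n + n) n) n, PhiP K n θ = y := by
  refine ⟨∑ l : Fin (n + 1), (y l * (((-1 : K) ^ (n.choose 2 + (n - (l : ℕ)))) * r K n)⁻¹) •
      op K n n n (Finset.range (n - (l : ℕ))),
    Submodule.sum_mem _ fun l _ => Submodule.smul_mem _ _ (op_mem_Hom_Gm K _ n le_rfl), ?_⟩
  rw [map_sum]
  funext l'
  rw [Finset.sum_apply, Finset.sum_eq_single l']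
  · rw [map_smul, PhiP_op, Pi.smul_apply, Pi.single_eq_same, smul_eq_mul, mul_assoc,
      inv_mul_cancel₀ (coeff_ne_zero K l'), mul_one]
  · intro l _ hl
    rw [map_smul, PhiP_op, Pi.smul_apply, Pi.single_eq_of_ne (Ne.symm hl), smul_zero]
  · intro h; exact absurd (Finset.mem_univ _) h

/-- `Φ₋` maps `E₋` ONTO the type space (every field). -/
lemma exists_EM_PhiM_eq (y : Fin (n + 1) → K) :
    ∃ θ ∈ Hom K (In (n + n)) (Dm (n + n) n) n, PhiM K n θ = y := by
  refine ⟨∑ l : Fin (n + 1), (y l * (((-1 : K) ^ (n.choose 2 + (n - (l : ℕ)))) * r K n)⁻¹) •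
      op K n 0 n (Finset.range (n - (l : ℕ))),
    Submodule.sum_mem _ fun l _ => Submodule.smul_mem _ _ (op_mem_Hom_Dm K _ n le_rfl), ?_⟩
  rw [map_sum]
  funext l'
  rw [Finset.sum_apply, Finset.sum_eq_single l']
  · rw [map_smul, PhiM_op, Pi.smul_apply, Pi.single_eq_same, smul_eq_mul, mul_assoc,
      inv_mul_cancel₀ (coeff_ne_zero K l'), mul_one]
  · intro l _ hl
    rw [map_smul, PhiM_op, Pi.smul_apply, Pi.single_eq_of_ne (Ne.symm hl), smul_zero]
  · intro h; exact absurd (Finset.mem_univ _) h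

/-! ### `M(q) = H Ω_n H` exactly, and the mirror factorisation -/

/-- `M(q) = H_n(q) Ω_n H_n(q)` (the signs `(−1)^{n·n}·(−1)ⁿ` cancel). -/
theorem Mcomp_eq_HOmegaH (q : ℕ → K) : Mcomp K n q = Hsq K n q * Omega K n * Hsq K n q := by
  have hsq : ((-1 : K) ^ (n * n)) * (-1) ^ n = 1 := by
    rw [← pow_add, show n * n + n = n * (n + 1) by ring]
    exact (Nat.even_mul_succ_self n).neg_one_pow
  rw [Mcomp, Omega'_eq, Matrix.mul_smul, Matrix.smul_mul, smul_smul, hsq, one_smul]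

/-- **the mirror factorisation `ψ₊ψ₋ ∣ E₋ = ι₋ ∘ M(q) ∘ Φ₋`.** -/
theorem psiP_psiM_eq (q : ℕ → K) {θ : HT K (In (n + n))} (hθ : θ ∈ Hom K (In (n + n)) (Dm (n + n) n) n) :
    psiP K n q (psiM K n q θ) = iotaM K n ((Mcomp K n q).mulVec (PhiM K n θ)) := by
  rw [psiM_eq K q hθ, psiP_eq K q (iotaP_mem K _), PhiP_iotaP, Matrix.mulVec_mulVec, Matrix.mulVec_mulVec, Mcomp,
    Matrix.smul_mulVec, map_smul]


/-! ### The images of `ψ₋ψ₊ ∣ E₊` and `ψ₊ψ₋ ∣ E₋` are `ι±(range M(q))` -/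

/-- `(E₊).map(ψ₋ψ₊) = ι₊(range M(q))`. -/
theorem map_psiMP_eq (q : ℕ → K) :
    (Hom K (In (n + n)) (Gm (n + n) n) n).map (psiM K n q ∘ₗ psiP K n q) =
      (LinearMap.range (Matrix.toLin' (Mcomp K n q))).map (iotaP K n) := by
  apply le_antisymm
  · rintro y hy
    obtain ⟨θ, hθ, rfl⟩ := Submodule.mem_map.mp hy
    refine Submodule.mem_map.mpr ⟨(Mcomp K n q).mulVec (PhiP K n θ), ⟨PhiP K n θ, Matrix.toLin'_apply _ _⟩, ?_⟩
    rw [LinearMap.comp_apply, psiM_psiP_eq K q hθ]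
  · rintro y hy
    obtain ⟨z, ⟨v, rfl⟩, rfl⟩ := Submodule.mem_map.mp hy
    obtain ⟨θ, hθ, hx⟩ := exists_EP_PhiP_eq K v
    refine Submodule.mem_map.mpr ⟨θ, hθ, ?_⟩
    rw [LinearMap.comp_apply, psiM_psiP_eq K q hθ, hx, Matrix.toLin'_apply]

/-- `(E₋).map(ψ₊ψ₋) = ι₋(range M(q))`. -/
theorem map_psiPM_eq (q : ℕ → K) :
    (Hom K (In (n + n)) (Dm (n + n) n) n).map (psiP K n q ∘ₗ psiM K n q) =
      (LinearMap.range (Matrix.toLin' (Mcomp K n q))).map (iotaM K n) := by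
  apply le_antisymm
  · rintro y hy
    obtain ⟨θ, hθ, rfl⟩ := Submodule.mem_map.mp hy
    refine Submodule.mem_map.mpr ⟨(Mcomp K n q).mulVec (PhiM K n θ), ⟨PhiM K n θ, Matrix.toLin'_apply _ _⟩, ?_⟩
    rw [LinearMap.comp_apply, psiP_psiM_eq K q hθ]
  · rintro y hy
    obtain ⟨z, ⟨v, rfl⟩, rfl⟩ := Submodule.mem_map.mp hy
    obtain ⟨θ, hθ, hx⟩ := exists_EM_PhiM_eq K v
    refine Submodule.mem_map.mpr ⟨θ, hθ, ?_⟩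
    rw [LinearMap.comp_apply, psiP_psiM_eq K q hθ, hx, Matrix.toLin'_apply]

/-- the rank of a matrix is the dimension of the range of `toLin'`. -/
lemma rank_eq_finrank_range_toLin' (M : Matrix (Fin (n + 1)) (Fin (n + 1)) K) :
    M.rank = Module.finrank K ↥(LinearMap.range (Matrix.toLin' M)) := by
  rw [Matrix.rank, Matrix.toLin'_apply']


/-- **`rank(ψ₋ψ₊ ∣ E₊) = rank(H_n(q) Ω_n H_n(q))`** (every field). -/
theorem finrank_map_psiMP (q : ℕ → K) :
    Module.finrank K ↥((Hom K (In (n + n)) (Gm (n + n) n) n).map (psiM K n q ∘ₗ psiP K n q)) =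
      (Hsq K n q * Omega K n * Hsq K n q).rank := by
  rw [map_psiMP_eq K q, finrank_map_of_injOn K (iotaP K n) _ (fun x _ hx => iotaP_injective K
    (by rw [hx, map_zero])), ← Mcomp_eq_HOmegaH, rank_eq_finrank_range_toLin']

/-- **`rank(ψ₊ψ₋ ∣ E₋) = rank(H_n(q) Ω_n H_n(q))`** (every field). -/
theorem finrank_map_psiPM (q : ℕ → K) :
    Module.finrank K ↥((Hom K (In (n + n)) (Dm (n + n) n) n).map (psiP K n q ∘ₗ psiM K n q)) =
      (Hsq K n q * Omega K n * Hsq K n q).rank := by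
  rw [map_psiPM_eq K q, finrank_map_of_injOn K (iotaM K n) _ (fun x _ hx => iotaM_injective K
    (by rw [hx, map_zero])), ← Mcomp_eq_HOmegaH, rank_eq_finrank_range_toLin']

/-! ### The one-sided columns in closed form -/

/-- **ONE-SIDED W-PURITY, `b = 0` (Weil type (n,n), m = n ≥ 1, `a ≠ 0`, every `q`, every field):**
`finrank range(∧(f + a·w₊) ∣ HTⁿ) + 2ρ + C(2n,n) = C(2n,n)·ρ + 2·C(2n,n) + rank(H_n(q) Ω_n H_n(q))`,
i.e. rank `= C(2n,n)(1+ρ) − 2ρ + rank(H_n Ω_n H_n)`. -/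
theorem weilPurity_oneSided_b_zero (hn : 1 ≤ n) (q : ℕ → K) {a : K} (ha : a ≠ 0) :
    Module.finrank K (LinearMap.range (wedge K (n + n) n (vW K (n + n) n q a 0))) +
        2 * (hankel1 K (n + n) n q).rank + (n + n).choose n =
      (n + n).choose n * (hankel1 K (n + n) n q).rank + ((n + n).choose n + (n + n).choose n) +
        (Hsq K n q * Omega K n * Hsq K n q).rank := by
  have h1 := weilPurity_schur K hn q ha (0 : K)
  have h2 := finrank_eq_map_add_inf_ker K (Hom K (In (n + n)) (Gm (n + n) n) n) (psiM K n q ∘ₗ psiP K n q)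
  have hE : Module.finrank K ↥(Hom K (In (n + n)) (Gm (n + n) n) n) = (n + n).choose n := by
    rw [finrank_Hom_eq, card_Gm_nn]
  have hS : schurOp K n q a 0 = psiM K n q ∘ₗ psiP K n q := by
    rw [schurOp, mul_zero, zero_smul, sub_zero]
  rw [hS] at h1
  rw [finrank_map_psiMP K q, hE] at h2
  omega

/-- **ONE-SIDED W-PURITY, `a = 0` (Weil type (n,n), m = n ≥ 1, `b ≠ 0`, every `q`, every field):**
`finrank range(∧(f + b·w₋) ∣ HTⁿ) + 2ρ + C(2n,n) = C(2n,n)·ρ + 2·C(2n,n) + rank(H_n(q) Ω_n H_n(q))`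
(via the mirrored Schur form `weilPurity_schur_mirror`). -/
theorem weilPurity_oneSided_a_zero (hn : 1 ≤ n) (q : ℕ → K) {b : K} (hb : b ≠ 0) :
    Module.finrank K (LinearMap.range (wedge K (n + n) n (vW K (n + n) n q 0 b))) +
        2 * (hankel1 K (n + n) n q).rank + (n + n).choose n =
      (n + n).choose n * (hankel1 K (n + n) n q).rank + ((n + n).choose n + (n + n).choose n) +
        (Hsq K n q * Omega K n * Hsq K n q).rank := by
  have h1 := weilPurity_schur_mirror K hn q (0 : K) hb
  have h2 := finrank_eq_map_add_inf_ker K (Hom K (In (n + n)) (Dm (n + n) n) n) (psiP K n q ∘ₗ psiM K n q)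
  have hE : Module.finrank K ↥(Hom K (In (n + n)) (Dm (n + n) n) n) = (n + n).choose n := by
    rw [finrank_Hom_eq, card_Dm_nn]
  have hS : schurOpM K n q 0 b = psiP K n q ∘ₗ psiM K n q := by
    rw [schurOpM, zero_mul, zero_smul, sub_zero]
  rw [hS] at h1
  rw [finrank_map_psiPM K q, hE] at h2
  omega

end OneSided

end Summit.Ventures.HSemireg.Wedge.Weil
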